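/-
Copyright (c) 2026 the pub-hodgecm-mathlib formalisation cell (harness21).  Prover seat hodgecm-mathlib-LH4-p08 (g3), req620 Track A «(D-RAM) FOUR-FRAME» squad
(heir LEAD F0P3a-plan lineage; dealer LH4-plan (g11) WORD #26 (2); MS ROAD A, Stage B₂ brick B56₂-MULT INPUT, FILE G2-A1: the STRUCTURE (P1) of a type-2 polarisation of the
glued frame; mathematics owed by LH4-p09 (g2)).  2026-09-04.
-/
import Summits.HodgeConjecture.HodgeConjecture.Theorems.F0P3cDyRamDiagonalGluedTubeCriterionTypeTwo    -- ★ p856270 (LH4-p09 (g2)): B5₂ (i) criterion (R), explicit form `D(f)`; brings ★ p855737 `formCongr_hnf_diagonal`, `det_coe_hnf`, `det_formCongr_diagonal`, `single_two_mem_latt_hnf_iff`, ★ `isVertexLattice_latt_iff_of_v`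
import Summits.HodgeConjecture.HodgeConjecture.Theorems.F0P3cDyRamDiagonalGluedStabiliserIndexCorner  -- ★ p856076 (F0P3-p01 (g31)): brings ★ `ne_zero_and_v_lt_one_of_v_eq_exp`, ★ `v_pow_eq_exp_neg` (and the stabiliser criterion used by FILE G2-A2)
import HarnessLib

/-!
# Crux `H413`, MS ROAD A, STAGE B₂ brick B56₂-MULT, FILE G2-A1: «THE STRUCTURE OF A TYPE-2 POLARISATION OF THE GLUED FRAME»

Cell `hodgecm-mathlib` (D-0151), FLOOR 0, crux item H413 = `stmt-HodgeConjecture-24833`; lane `--supports stmt-HodgeConjecture-24833 --as helper` (count-neutral).  THEOREMS ONLY.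
After LH4-p09 (g2)'s flag (2026-09-04T00:42:58Z; ratified LH4-p10 (g2) 00:58:37Z, dealer WORD #21∕#26, LEAD (R-21)) the type-2 half of the (MS) stable model sum is RE-KEYED on the
MULTIPLICITY `polarisationCount σ ϖ 2 M = #(Δ₂(M) ∕ S_F(M))` (★ StrataDefs ED. 3): the number of classes of non-degenerate `σ`-fixed diagonal forms `diag D` for which `M` is a type-2
vertex lattice, modulo the fixed unit stabiliser `S_F(M)` acting by `D ↦ D·u`.  For the glued type-2 frame `V = (1 0 0; x ϖ^ρ 0; xζ+y″ ϖ^ρζ ϖ^{2ρ+1+s})` (`|x| = |ζ| = 1`,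
`|y″| = |ϖ|^s`, `ρ ≥ 1`, `s` even `≥ 2`) over a ramified quadratic datum, THIS FILE is LH4-p09 (g2)'s owed item (P1) — the STRUCTURE of an ARBITRARY type-2 polarisation `D` of `latt V`,
in terms of its (R)-PARAMETER `f_D := −(D₁ + D₂·Nζ)∕D₂` (`Nζ = ζσζ`):
* `fParam_fixed_criterionR_v_inv_le` — `σ f_D = f_D`, (R) `|ζσy″ − σx·f_D| ≤ |ϖ|^{ρ+s}`, `|D₂|⁻¹ ≤ |ϖ|^{2ρ+s}` (★ p856270 §2, whose existential witness IS `f_D`; kept with the witness);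
* `v_fParam_eq` — `|f_D| = |ϖ|^s`;  `D_one_eq_and_v_eq` — `D₁ = −D₂(Nζ + f_D)`, `|Nζ + f_D| = 1`, `|D₁| = |D₂|`;
* `v_D_two_eq` — `|D₂| = |ϖ|^{−(2ρ+s)}` EXACTLY (dual-lattice bound, integrality of `G₀₂`, PARITY of fixed valuations);  `v_D_zero_eq` — `|D₀| = |ϖ|^{−2ρ}` (determinant);
* `v_cofactor_le` — the binding type-2 COFACTOR congruence `|f_D·G₀₀ + D₂·N(B)| ≤ |ϖ|^{s+1}` (`B = ζσy″ − σx·f_D`, `G₀₀ = D₀ + NxD₁ + NyD₂`; `ϖ·G⁻¹` integral at entry `(2,2)`),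
  which pins `D₀` modulo `𝔭_F` once `(D₂, f_D)` are given;  `structure_of_polarisation` — the summary.
FILE G2-A2 (`…GluedPolarisationClassesTypeTwo`) turns this into the STABILISER-RELATEDNESS criterion (P2)∕(P3), FILE G2-B into the COUNT `polarisationCount = q ∕ 1`.
HONEST LABEL.  Count-neutral; the census laws stay PROVER TARGETS until the MS assembly lands; `HC_CM` is proved only modulo the 7 printed citations (2 remaining named inputs:
hLiu418 = `stmt-HodgeConjecture-24832`, h413 = `stmt-HodgeConjecture-24833`) until rung 0 closes.

## References
* [Jacobowitz1962] R. Jacobowitz, *Hermitian forms over local fields*, Amer. J. Math. 84 (1962), §7 (modular lattices, Gram matrices, dual bases).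
* [Kottwitz1986BaseChangeUnits] R. Kottwitz, *Base change for unit elements of Hecke algebras*, Compositio Math. 60 (1986), §1 pp. 240–241 (fixed-lattice counting, torus stabilisers).
* [Serre1979] J.-P. Serre, *Local Fields*, GTM 67 (1979), Ch. I §6 Prop. 18 (totally ramified quadratic extensions: fixed elements have even valuation).
-/

set_option autoImplicit false

noncomputable section

namespace Summit.HodgeConjecture.HodgeConjecture.Cruxes.H413.F0P3cDyRamDiagonalGluedPolarisationStructureTypeTwo

open Matrix
open Literature.NumberTheory.Automorphic Literature.NumberTheory.Automorphic.HermitianLattice Literature.NumberTheory.Automorphic.UnitaryGroup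
open Literature.NumberTheory.Automorphic.UnitaryLatticeTree
open Summit.HodgeConjecture.HodgeConjecture.Cruxes.H413.F0P3cDyRamDiagonalTorusDefs
open Summit.HodgeConjecture.HodgeConjecture.Cruxes.H413.F0P3cDyRamDiagonalStableLatticeHNF
open Summit.HodgeConjecture.HodgeConjecture.Cruxes.H413.F0P3cDyRamDiagonalGluedTubeCriterion
open Summit.HodgeConjecture.HodgeConjecture.Cruxes.H413.F0P3cDyRamDiagonalGluedTubeCriterionTypeTwo
open Summit.HodgeConjecture.HodgeConjecture.Cruxes.H413.F0P3cDyRamDiagonalGluedStabiliserIndex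
open Summit.HodgeConjecture.HodgeConjecture.Cruxes.H413.F0P3cDyRamDiagonalGluedStabiliserIndexCorner
open scoped Valued WithZero Matrix MatrixGroups

variable {K : Type*} [Field K] [Valued K ℤᵐ⁰]

/-! ## §1 (P1)  Structure of an arbitrary type-2 polarisation of the glued frame -/

/-- **(P1a) THE (R)-PARAMETER OF A POLARISATION**: if `latt V` is a type-2 vertex lattice of the fixed non-degenerate form `diag D`, then `f_D := −(D₁ + D₂·Nζ)∕D₂` is `σ`-fixed,
satisfies (R) `|ζσy″ − σx·f_D| ≤ |ϖ|^{ρ+s}`, and `|D₂|⁻¹ ≤ |ϖ|^{2ρ+s}` (`ϖ·D₂⁻¹e₃ ∈ ϖM^♯ ⊆ M` lies on the axis `𝔭^{2ρ+1+s}e₃`; then the Gram entry `G₀₁ = ϖ^ρD₂(ζσy″ − σx·f_D)`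
is integral).  The proof of ★ `exists_fixed_of_isTypeTwoPolarisable_latt_hnf_glued` (LH4-p09 (g2)), kept with its witness. [cite: Jacobowitz1962, §7] [cite: Kottwitz1986BaseChangeUnits, §1 pp. 240–241] -/
theorem fParam_fixed_criterionR_v_inv_le {σ : K →+* K} (hσ : ∀ a, σ (σ a) = a) (hvσ : ∀ a, Valued.v (σ a) = Valued.v a)
    {ϖ : K} (hϖ0 : ϖ ≠ 0) (hϖ1 : Valued.v ϖ ≤ 1) (ρ s : ℕ) {x ζ y'' : K} (hx : Valued.v x ≤ 1) (hζ : Valued.v ζ ≤ 1) (hy'' : Valued.v y'' ≤ 1)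
    (V : GL (Fin 3) K) (hV : (V : Matrix (Fin 3) (Fin 3) K) = !![1, 0, 0; x, ϖ ^ ρ, 0; x * ζ + y'', ϖ ^ ρ * ζ, ϖ ^ (2 * ρ + 1 + s)])
    {D : Fin 3 → K} (hD : ∀ i, σ (D i) = D i ∧ D i ≠ 0) (hvert : IsVertexLattice σ ϖ (Matrix.diagonal D) 2 (latt (V : Matrix (Fin 3) (Fin 3) K)))
    {f : K} (hfD : f = -(D 1 + D 2 * (ζ * σ ζ)) / D 2) :
    σ f = f ∧ Valued.v (ζ * σ y'' - σ x * f) ≤ Valued.v ϖ ^ (ρ + s) ∧ Valued.v (D 2)⁻¹ ≤ Valued.v ϖ ^ (2 * ρ + s) := by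
  -- adapted from ★ p856270 §2 (LH4-p09 (g2)), whose existential witness IS `f_D`
  subst hfD
  set c : ℕ := 2 * ρ + 1 + s with hc
  have hvϖ : 0 < Valued.v ϖ := (Valuation.pos_iff _).2 hϖ0
  have hpc : (ϖ ^ ρ : K) ≠ 0 := pow_ne_zero _ hϖ0
  have hrc : (ϖ ^ c : K) ≠ 0 := pow_ne_zero _ hϖ0
  have hD2 : D 2 ≠ 0 := (hD 2).2
  have hdetD : IsUnit (Matrix.diagonal D).det := by
    rw [Matrix.det_diagonal, Fin.prod_univ_three]
    exact (mul_ne_zero (mul_ne_zero (hD 0).2 (hD 1).2) hD2).isUnit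
  have hy : Valued.v (x * ζ + y'') ≤ 1 :=
    (Valuation.map_add _ _ _).trans (max_le (by rw [map_mul]; exact mul_le_one' hx hζ) hy'')
  have hint : ∀ m ∈ latt (V : Matrix (Fin 3) (Fin 3) K), ∀ i, Valued.v (m i) ≤ 1 := by
    intro m hm i
    rw [hV] at hm
    have hle := latt_hnf_le_stdLattice (x := x) (y := x * ζ + y'') (z := ϖ ^ ρ * ζ) (p := ϖ ^ ρ) (r := ϖ ^ c) hx hy
      (by rw [map_mul, map_pow]; exact mul_le_one' (pow_le_one' hϖ1 _) hζ) (by rw [map_pow]; exact pow_le_one' hϖ1 _) (by rw [map_pow]; exact pow_le_one' hϖ1 _)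
    exact (mem_stdLattice.1 (hle hm)) i
  have hw' : Pi.single (2 : Fin 3) (D 2)⁻¹ ∈ dualLatt σ (Matrix.diagonal D) (latt (V : Matrix (Fin 3) (Fin 3) K)) := by
    rw [mem_dualLatt]
    intro m hm
    rw [pairing_apply]
    have hsum : ∑ i : Fin 3, ∑ j : Fin 3, σ (m i) * Matrix.diagonal D i j * (Pi.single (2 : Fin 3) (D 2)⁻¹ : Fin 3 → K) j = σ (m 2) := by
      simp [Matrix.diagonal, Pi.single_apply, hD2]
    rw [hsum, hvσ]
    exact hint m hm 2
  have hw : Pi.single (2 : Fin 3) (ϖ * (D 2)⁻¹) ∈ latt (V : Matrix (Fin 3) (Fin 3) K) := by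
    refine scaleLattice_dualLatt_le_of_isVertexLattice hvσ hdetD hvert ((mem_scaleLattice_iff hϖ0 _ _).2 ?_)
    rwa [← smul_eq_mul, Pi.single_smul', smul_smul, inv_mul_cancel₀ hϖ0, one_smul]
  have hD2v : Valued.v (D 2)⁻¹ ≤ Valued.v ϖ ^ (2 * ρ + s) := by
    rw [hV] at hw
    have h := (single_two_mem_latt_hnf_iff x (x * ζ + y'') (ϖ ^ ρ * ζ) hpc hrc _).1 hw
    rw [map_mul, map_pow, hc, show 2 * ρ + 1 + s = (2 * ρ + s) + 1 by ring, pow_succ, mul_comm (Valued.v ϖ ^ (2 * ρ + s)) (Valued.v ϖ)] at h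
    exact le_of_mul_le_mul_left h hvϖ
  have hG := ((isVertexLattice_latt_iff_of_v σ hvσ hϖ0 (Matrix.diagonal D) 2 V).1 hvert).1
  have h01 := hG 0 1
  rw [formCongr_hnf_diagonal σ D x (x * ζ + y'') (ϖ ^ ρ * ζ) (ϖ ^ ρ) (ϖ ^ c) V hV] at h01
  simp only [Matrix.of_apply, Matrix.cons_val', Matrix.cons_val_zero, Matrix.cons_val_one, Matrix.empty_val', Matrix.cons_val_fin_one] at h01
  refine ⟨?_, ?_, hD2v⟩
  · rw [map_div₀, map_neg, map_add, map_mul, map_mul, hσ, (hD 1).1, (hD 2).1, mul_comm (σ ζ) ζ]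
  · have hrew : σ x * D 1 * ϖ ^ ρ + σ (x * ζ + y'') * D 2 * (ϖ ^ ρ * ζ) = ϖ ^ ρ * D 2 * (ζ * σ y'' - σ x * (-(D 1 + D 2 * (ζ * σ ζ)) / D 2)) := by
      rw [map_add, map_mul]; field_simp; ring
    rw [hrew, map_mul, map_mul, map_pow] at h01
    have hD2pos : 0 < Valued.v (D 2) := (Valuation.pos_iff _).2 hD2
    have hϖρpos : 0 < Valued.v ϖ ^ ρ := pow_pos hvϖ _
    rw [map_inv₀] at hD2v
    have key : Valued.v (ζ * σ y'' - σ x * (-(D 1 + D 2 * (ζ * σ ζ)) / D 2)) ≤ (Valued.v ϖ ^ ρ * Valued.v (D 2))⁻¹ := by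
      rw [← one_mul (Valued.v ϖ ^ ρ * Valued.v (D 2))⁻¹, le_mul_inv_iff₀ (mul_pos hϖρpos hD2pos)]
      calc Valued.v (ζ * σ y'' - σ x * (-(D 1 + D 2 * (ζ * σ ζ)) / D 2)) * (Valued.v ϖ ^ ρ * Valued.v (D 2))
          = Valued.v ϖ ^ ρ * Valued.v (D 2) * Valued.v (ζ * σ y'' - σ x * (-(D 1 + D 2 * (ζ * σ ζ)) / D 2)) := mul_comm _ _
        _ ≤ 1 := h01
    refine key.trans ?_
    rw [mul_inv]
    calc (Valued.v ϖ ^ ρ)⁻¹ * (Valued.v (D 2))⁻¹ ≤ (Valued.v ϖ ^ ρ)⁻¹ * Valued.v ϖ ^ (2 * ρ + s) := mul_le_mul_right hD2v _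
      _ = Valued.v ϖ ^ (ρ + s) := by
          rw [show 2 * ρ + s = ρ + (ρ + s) by ring, pow_add, inv_mul_cancel_left₀ hϖρpos.ne']

/-- **(P1b) `|f_D| = |ϖ|^s`** for any (R)-parameter (`|x| = |ζ| = 1`, `|y″| = |ϖ|^s`, `ρ ≥ 1`): `|ζσy″| = |ϖ|^s` and (R) makes `σx·f_D` agree with it to higher order.
[cite: Kottwitz1986BaseChangeUnits, §1 pp. 240–241] -/
theorem v_fParam_eq {σ : K →+* K} (hvσ : ∀ a, Valued.v (σ a) = Valued.v a) {ϖ : K} (hϖ0 : ϖ ≠ 0) (hϖ1 : Valued.v ϖ < 1)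
    {ρ : ℕ} (hρ : 1 ≤ ρ) (s : ℕ) {x ζ y'' : K} (hx : Valued.v x = 1) (hζ : Valued.v ζ = 1) (hy'' : Valued.v y'' = Valued.v ϖ ^ s)
    {f : K} (hR : Valued.v (ζ * σ y'' - σ x * f) ≤ Valued.v ϖ ^ (ρ + s)) : Valued.v f = Valued.v ϖ ^ s := by
  have hvϖ : 0 < Valued.v ϖ := (Valuation.pos_iff _).2 hϖ0
  have h1 : Valued.v (ζ * σ y'') = Valued.v ϖ ^ s := by rw [map_mul, hζ, hvσ, hy'', one_mul]
  have hlt : Valued.v (ζ * σ y'' - σ x * f) < Valued.v (ζ * σ y'') :=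
    hR.trans_lt (by rw [h1]; exact pow_lt_pow_right_of_lt_one₀ hvϖ hϖ1 (by omega))
  have hvxf : Valued.v (σ x * f) = Valued.v (ζ * σ y'') := by
    have e : σ x * f = ζ * σ y'' + -(ζ * σ y'' - σ x * f) := by ring
    rw [e]; exact Valuation.map_add_eq_of_lt_left _ (by rwa [Valuation.map_neg])
  rw [map_mul, hvσ, hx, one_mul] at hvxf
  exact hvxf.trans h1

/-- **(P1c) `|D₂| = |ϖ|^{−(2ρ+s)}` EXACTLY** (`s` even): `|D₂|⁻¹ ≤ |ϖ|^{2ρ+s}` ((P1a)), the Gram entry `G₀₂ = σ(xζ+y″)·D₂·ϖ^{2ρ+1+s}` is integral so `|D₂| ≤ |ϖ|^{−(2ρ+s+1)}`, and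
`D₂` is a non-zero FIXED element, so its valuation is an even power of `|ϖ|` — the only even exponent in `[2ρ+s, 2ρ+s+1]` is `2ρ+s`.
[cite: Serre1979, Ch. I §6 Prop. 18] [cite: Jacobowitz1962, §7] [cite: Kottwitz1986BaseChangeUnits, §1 pp. 240–241] -/
theorem v_D_two_eq {σ : K →+* K} (hσ : ∀ a, σ (σ a) = a) (hvσ : ∀ a, Valued.v (σ a) = Valued.v a)
    (hfix : ∀ x : K, σ x = x → x ≠ 0 → ∃ n : ℤ, Valued.v x = WithZero.exp (2 * n)) {ϖ : K} (hϖ : Valued.v ϖ = WithZero.exp (-1 : ℤ))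
    (ρ s : ℕ) (hs2 : 2 ∣ s) (hs : 1 ≤ s) {x ζ y'' : K} (hx : Valued.v x = 1) (hζ : Valued.v ζ = 1) (hy'' : Valued.v y'' = Valued.v ϖ ^ s)
    (V : GL (Fin 3) K) (hV : (V : Matrix (Fin 3) (Fin 3) K) = !![1, 0, 0; x, ϖ ^ ρ, 0; x * ζ + y'', ϖ ^ ρ * ζ, ϖ ^ (2 * ρ + 1 + s)])
    {D : Fin 3 → K} (hD : ∀ i, σ (D i) = D i ∧ D i ≠ 0) (hvert : IsVertexLattice σ ϖ (Matrix.diagonal D) 2 (latt (V : Matrix (Fin 3) (Fin 3) K))) :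
    Valued.v (D 2) = (Valued.v ϖ ^ (2 * ρ + s))⁻¹ := by
  obtain ⟨hϖ0, hϖ1⟩ := ne_zero_and_v_lt_one_of_v_eq_exp hϖ
  have hvϖ : 0 < Valued.v ϖ := (Valuation.pos_iff _).2 hϖ0
  obtain ⟨-, -, hlow⟩ := fParam_fixed_criterionR_v_inv_le hσ hvσ hϖ0 hϖ1.le ρ s hx.le hζ.le (by rw [hy'']; exact pow_le_one₀ zero_le hϖ1.le) V hV hD hvert rfl
  -- upper bound from `G₀₂`
  have hG := ((isVertexLattice_latt_iff_of_v σ hvσ hϖ0 (Matrix.diagonal D) 2 V).1 hvert).1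
  have h02 := hG 0 2
  rw [formCongr_hnf_diagonal σ D x (x * ζ + y'') (ϖ ^ ρ * ζ) (ϖ ^ ρ) (ϖ ^ (2 * ρ + 1 + s)) V hV] at h02
  simp only [Matrix.of_apply, Matrix.cons_val', Matrix.cons_val_zero, Matrix.cons_val_two, Matrix.empty_val', Matrix.cons_val_fin_one,
    Matrix.tail_cons, Matrix.head_cons] at h02
  have hvy : Valued.v (x * ζ + y'') = 1 := by
    have hlt : Valued.v y'' < Valued.v (x * ζ) := by
      rw [map_mul, hx, hζ, one_mul, hy'']; exact pow_lt_one₀ zero_le hϖ1 (by omega)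
    rw [Valuation.map_add_eq_of_lt_left _ hlt, map_mul, hx, hζ, one_mul]
  rw [map_mul, map_mul, hvσ, hvy, one_mul, map_pow] at h02
  -- parity
  obtain ⟨n, hn⟩ := hfix (D 2) (hD 2).1 (hD 2).2
  obtain ⟨t, rfl⟩ := hs2
  rw [map_inv₀] at hlow
  rw [hn] at h02 hlow ⊢
  rw [v_pow_eq_exp_neg hϖ] at h02 hlow ⊢
  rw [← WithZero.exp_neg] at hlow ⊢
  rw [← WithZero.exp_add, ← WithZero.exp_zero, WithZero.exp_le_exp] at h02
  rw [WithZero.exp_le_exp] at hlow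
  congr 1
  push_cast at h02 hlow ⊢
  omega

/-- **(P1d) `D₁ = −D₂(Nζ + f_D)` and `|D₁| = |D₂|`** (`|Nζ| = 1 > |ϖ|^s = |f_D|`). [cite: Kottwitz1986BaseChangeUnits, §1 pp. 240–241] -/
theorem D_one_eq_and_v_eq {σ : K →+* K} (hvσ : ∀ a, Valued.v (σ a) = Valued.v a) {ϖ : K} (hϖ1 : Valued.v ϖ < 1)
    {s : ℕ} (hs : 1 ≤ s) {ζ : K} (hζ : Valued.v ζ = 1) {D : Fin 3 → K} (hD2 : D 2 ≠ 0)
    {f : K} (hfD : f = -(D 1 + D 2 * (ζ * σ ζ)) / D 2) (hvf : Valued.v f = Valued.v ϖ ^ s) :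
    D 1 = -(D 2 * (ζ * σ ζ + f)) ∧ Valued.v (ζ * σ ζ + f) = 1 ∧ Valued.v (D 1) = Valued.v (D 2) := by
  have hD1 : D 1 = -(D 2 * (ζ * σ ζ + f)) := by
    rw [hfD]; field_simp; ring
  have hvNζ : Valued.v (ζ * σ ζ) = 1 := by rw [map_mul, hvσ, hζ, one_mul]
  have hvNf : Valued.v (ζ * σ ζ + f) = 1 := by
    rw [Valuation.map_add_eq_of_lt_left _ (by rw [hvNζ, hvf]; exact pow_lt_one₀ zero_le hϖ1 (by omega)), hvNζ]
  exact ⟨hD1, hvNf, by rw [hD1, Valuation.map_neg, map_mul, hvNf, mul_one]⟩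

/-- **(P1e) `|D₀| = |ϖ|^{−2ρ}`** from the determinant: `|det G| = |ϖ|²` with `det G = σ(det V)·D₀D₁D₂·det V`, `det V = ϖ^ρ·ϖ^{2ρ+1+s}`, `|D₁| = |D₂| = |ϖ|^{−(2ρ+s)}`.
[cite: Jacobowitz1962, §7] [cite: Kottwitz1986BaseChangeUnits, §1 pp. 240–241] -/
theorem v_D_zero_eq {σ : K →+* K} (hvσ : ∀ a, Valued.v (σ a) = Valued.v a) {ϖ : K} (hϖ : Valued.v ϖ = WithZero.exp (-1 : ℤ)) (ρ s : ℕ)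
    {x ζ y'' : K} (V : GL (Fin 3) K) (hV : (V : Matrix (Fin 3) (Fin 3) K) = !![1, 0, 0; x, ϖ ^ ρ, 0; x * ζ + y'', ϖ ^ ρ * ζ, ϖ ^ (2 * ρ + 1 + s)])
    {D : Fin 3 → K} (hD : ∀ i, σ (D i) = D i ∧ D i ≠ 0) (hvert : IsVertexLattice σ ϖ (Matrix.diagonal D) 2 (latt (V : Matrix (Fin 3) (Fin 3) K)))
    (hvD2 : Valued.v (D 2) = (Valued.v ϖ ^ (2 * ρ + s))⁻¹) (hvD1 : Valued.v (D 1) = Valued.v (D 2)) :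
    Valued.v (D 0) = (Valued.v ϖ ^ (2 * ρ))⁻¹ := by
  obtain ⟨hϖ0, -⟩ := ne_zero_and_v_lt_one_of_v_eq_exp hϖ
  have hdet := ((isVertexLattice_latt_iff_of_v σ hvσ hϖ0 (Matrix.diagonal D) 2 V).1 hvert).2.2
  rw [det_formCongr_diagonal, det_coe_hnf x (x * ζ + y'') (ϖ ^ ρ * ζ) (ϖ ^ ρ) (ϖ ^ (2 * ρ + 1 + s)) V hV] at hdet
  simp only [map_mul, hvσ, map_pow, hvD1, hvD2] at hdet
  obtain ⟨m, hm⟩ : ∃ m : ℤ, Valued.v (D 0) = WithZero.exp m := by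
    have h0 : Valued.v (D 0) ≠ 0 := (Valuation.ne_zero_iff _).2 (hD 0).2
    exact ⟨WithZero.log (Valued.v (D 0)), (WithZero.exp_log h0).symm⟩
  rw [hm] at hdet ⊢
  rw [v_pow_eq_exp_neg hϖ, ← WithZero.exp_neg]
  rw [v_pow_eq_exp_neg hϖ, v_pow_eq_exp_neg hϖ, v_pow_eq_exp_neg hϖ, hϖ, ← WithZero.exp_neg] at hdet
  simp only [← WithZero.exp_add, sq] at hdet
  rw [WithZero.exp_inj] at hdet
  congr 1
  push_cast at hdet ⊢
  omega

/-- **(P1f) THE TYPE-2 COFACTOR CONGRUENCE `|f_D·G₀₀ + D₂·N(B)| ≤ |ϖ|^{s+1}`** (`B = ζσy″ − σx·f_D`, `N(B) = B·σB`, `σB = σζ·y″ − x·f_D`, `G₀₀ = D₀ + Nx·D₁ + Ny·D₂`,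
`y = xζ + y″`): `ϖ·G⁻¹` is integral, so the `(2,2)` cofactor `G₀₀G₁₁ − G₀₁G₁₀` of the Gram matrix has valuation `≤ |det G|∕|ϖ| = |ϖ|`; and `G₁₁ = −N(ϖ^ρ)D₂f_D`,
`G₀₁ = ϖ^ρD₂B`, `G₁₀ = σ(ϖ^ρ)D₂σB`, so that cofactor is `−N(ϖ^ρ)·D₂·(f_D·G₀₀ + D₂·N(B))` with `|N(ϖ^ρ)·D₂| = |ϖ|^{−s}`.  This congruence pins `D₀` modulo `𝔭_F`.
[cite: Jacobowitz1962, §7] [cite: Kottwitz1986BaseChangeUnits, §1 pp. 240–241] -/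
theorem v_cofactor_le {σ : K →+* K} (hvσ : ∀ a, Valued.v (σ a) = Valued.v a) {ϖ : K} (hϖ0 : ϖ ≠ 0) (ρ s : ℕ)
    {x ζ y'' : K} (V : GL (Fin 3) K) (hV : (V : Matrix (Fin 3) (Fin 3) K) = !![1, 0, 0; x, ϖ ^ ρ, 0; x * ζ + y'', ϖ ^ ρ * ζ, ϖ ^ (2 * ρ + 1 + s)])
    {D : Fin 3 → K} (hvert : IsVertexLattice σ ϖ (Matrix.diagonal D) 2 (latt (V : Matrix (Fin 3) (Fin 3) K)))
    (hvD2 : Valued.v (D 2) = (Valued.v ϖ ^ (2 * ρ + s))⁻¹) {f : K} (hD1 : D 1 = -(D 2 * (ζ * σ ζ + f))) :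
    Valued.v (f * (D 0 + σ x * D 1 * x + σ (x * ζ + y'') * D 2 * (x * ζ + y'')) + D 2 * ((ζ * σ y'' - σ x * f) * (σ ζ * y'' - x * f))) ≤
      Valued.v ϖ ^ (s + 1) := by
  have hvϖ : 0 < Valued.v ϖ := (Valuation.pos_iff _).2 hϖ0
  obtain ⟨-, hinv, hdet⟩ := (isVertexLattice_latt_iff_of_v σ hvσ hϖ0 (Matrix.diagonal D) 2 V).1 hvert
  have hG := formCongr_hnf_diagonal σ D x (x * ζ + y'') (ϖ ^ ρ * ζ) (ϖ ^ ρ) (ϖ ^ (2 * ρ + 1 + s)) V hV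
  have hadj : (formCongr σ V (Matrix.diagonal D)).adjugate 2 2 =
      (D 0 + σ x * D 1 * x + σ (x * ζ + y'') * D 2 * (x * ζ + y'')) * (σ (ϖ ^ ρ) * D 1 * ϖ ^ ρ + σ (ϖ ^ ρ * ζ) * D 2 * (ϖ ^ ρ * ζ)) -
        (σ x * D 1 * ϖ ^ ρ + σ (x * ζ + y'') * D 2 * (ϖ ^ ρ * ζ)) * (σ (ϖ ^ ρ) * D 1 * x + σ (ϖ ^ ρ * ζ) * D 2 * (x * ζ + y'')) := by
    rw [hG, Matrix.adjugate_fin_three_of]; rfl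
  have h22 := hinv 2 2
  rw [Matrix.smul_apply, Matrix.inv_def, Ring.inverse_eq_inv, Matrix.smul_apply, smul_eq_mul, smul_eq_mul, map_mul, map_mul, map_inv₀, hdet, hadj] at h22
  -- the cofactor in `(D₂, f)`-letters
  have hcof : (D 0 + σ x * D 1 * x + σ (x * ζ + y'') * D 2 * (x * ζ + y'')) * (σ (ϖ ^ ρ) * D 1 * ϖ ^ ρ + σ (ϖ ^ ρ * ζ) * D 2 * (ϖ ^ ρ * ζ)) -
        (σ x * D 1 * ϖ ^ ρ + σ (x * ζ + y'') * D 2 * (ϖ ^ ρ * ζ)) * (σ (ϖ ^ ρ) * D 1 * x + σ (ϖ ^ ρ * ζ) * D 2 * (x * ζ + y'')) =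
      -(σ ϖ ^ ρ * ϖ ^ ρ * D 2) *
        (f * (D 0 + σ x * D 1 * x + σ (x * ζ + y'') * D 2 * (x * ζ + y'')) + D 2 * ((ζ * σ y'' - σ x * f) * (σ ζ * y'' - x * f))) := by
    have e1 : σ (ϖ ^ ρ * ζ) = σ ϖ ^ ρ * σ ζ := by rw [map_mul, map_pow]
    have e2 : σ (x * ζ + y'') = σ x * σ ζ + σ y'' := by rw [map_add, map_mul]
    rw [map_pow, e1, e2, hD1]; ring
  rw [hcof, map_mul, Valuation.map_neg, map_mul, map_mul, map_pow, hvσ, map_pow, hvD2] at h22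
  -- `|ϖ| · |ϖ|⁻² · (|ϖ|^{2ρ} |ϖ|^{-(2ρ+s)} · X) ≤ 1  ⟹  X ≤ |ϖ|^{s+1}`
  set X := Valued.v (f * (D 0 + σ x * D 1 * x + σ (x * ζ + y'') * D 2 * (x * ζ + y'')) + D 2 * ((ζ * σ y'' - σ x * f) * (σ ζ * y'' - x * f))) with hX
  have hne : ∀ n : ℕ, Valued.v ϖ ^ n ≠ 0 := fun n => pow_ne_zero _ hvϖ.ne'
  have hcalc : Valued.v ϖ * ((Valued.v ϖ ^ 2)⁻¹ * (Valued.v ϖ ^ ρ * Valued.v ϖ ^ ρ * (Valued.v ϖ ^ (2 * ρ + s))⁻¹ * X)) = X * (Valued.v ϖ ^ (s + 1))⁻¹ := by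
    have e3 : Valued.v ϖ ^ (2 * ρ + s) = Valued.v ϖ ^ ρ * Valued.v ϖ ^ ρ * Valued.v ϖ ^ s := by rw [← pow_add, ← pow_add]; congr 1; ring
    have e4 : Valued.v ϖ ^ (s + 1) = Valued.v ϖ ^ s * Valued.v ϖ := by rw [pow_succ]
    have e5 : Valued.v ϖ ^ 2 = Valued.v ϖ * Valued.v ϖ := sq _
    rw [e3, e4, e5, mul_inv, mul_inv, mul_inv, mul_inv]
    field_simp
  rw [hcalc, mul_inv_le_iff₀ (pow_pos hvϖ _), one_mul] at h22
  exact h22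

/-- **(P1) STRUCTURE OF A TYPE-2 POLARISATION OF THE GLUED FRAME — SUMMARY**: for `V = (1 0 0; x ϖ^ρ 0; xζ+y″ ϖ^ρζ ϖ^{2ρ+1+s})` (`|x| = |ζ| = 1`, `|y″| = |ϖ|^s`, `ρ ≥ 1`,
`s` even `≥ 2`) over a ramified quadratic datum and a fixed non-degenerate `diag D` polarising `latt V` at type 2, with `f_D := −(D₁ + D₂Nζ)∕D₂`:
`σf_D = f_D`, (R), `|f_D| = |ϖ|^s`, `D₁ = −D₂(Nζ+f_D)`, `|Nζ + f_D| = 1`, `|D₂| = |ϖ|^{−(2ρ+s)}`, `|D₁| = |D₂|`, `|D₀| = |ϖ|^{−2ρ}`, and the cofactor congruence (P1f).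
[cite: Jacobowitz1962, §7] [cite: Kottwitz1986BaseChangeUnits, §1 pp. 240–241] [cite: Serre1979, Ch. I §6 Prop. 18] -/
theorem structure_of_polarisation {σ : K →+* K} (hσ : ∀ a, σ (σ a) = a) (hvσ : ∀ a, Valued.v (σ a) = Valued.v a)
    (hfix : ∀ x : K, σ x = x → x ≠ 0 → ∃ n : ℤ, Valued.v x = WithZero.exp (2 * n)) {ϖ : K} (hϖ : Valued.v ϖ = WithZero.exp (-1 : ℤ))
    {ρ : ℕ} (hρ : 1 ≤ ρ) (s : ℕ) (hs2 : 2 ∣ s) (hs : 1 ≤ s) {x ζ y'' : K} (hx : Valued.v x = 1) (hζ : Valued.v ζ = 1) (hy'' : Valued.v y'' = Valued.v ϖ ^ s)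
    (V : GL (Fin 3) K) (hV : (V : Matrix (Fin 3) (Fin 3) K) = !![1, 0, 0; x, ϖ ^ ρ, 0; x * ζ + y'', ϖ ^ ρ * ζ, ϖ ^ (2 * ρ + 1 + s)])
    {D : Fin 3 → K} (hD : ∀ i, σ (D i) = D i ∧ D i ≠ 0) (hvert : IsVertexLattice σ ϖ (Matrix.diagonal D) 2 (latt (V : Matrix (Fin 3) (Fin 3) K)))
    {f : K} (hfD : f = -(D 1 + D 2 * (ζ * σ ζ)) / D 2) :
    (σ f = f ∧ Valued.v (ζ * σ y'' - σ x * f) ≤ Valued.v ϖ ^ (ρ + s) ∧ Valued.v f = Valued.v ϖ ^ s) ∧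
      (D 1 = -(D 2 * (ζ * σ ζ + f)) ∧ Valued.v (ζ * σ ζ + f) = 1) ∧
      (Valued.v (D 2) = (Valued.v ϖ ^ (2 * ρ + s))⁻¹ ∧ Valued.v (D 1) = Valued.v (D 2) ∧ Valued.v (D 0) = (Valued.v ϖ ^ (2 * ρ))⁻¹) ∧
      Valued.v (f * (D 0 + σ x * D 1 * x + σ (x * ζ + y'') * D 2 * (x * ζ + y'')) + D 2 * ((ζ * σ y'' - σ x * f) * (σ ζ * y'' - x * f))) ≤
        Valued.v ϖ ^ (s + 1) := by
  obtain ⟨hϖ0, hϖ1⟩ := ne_zero_and_v_lt_one_of_v_eq_exp hϖ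
  obtain ⟨hf, hR, -⟩ := fParam_fixed_criterionR_v_inv_le hσ hvσ hϖ0 hϖ1.le ρ s hx.le hζ.le (by rw [hy'']; exact pow_le_one₀ zero_le hϖ1.le) V hV hD hvert hfD
  have hvf := v_fParam_eq hvσ hϖ0 hϖ1 hρ s hx hζ hy'' hR
  obtain ⟨hD1, hvNf, hvD1⟩ := D_one_eq_and_v_eq hvσ hϖ1 hs hζ (hD 2).2 hfD hvf
  have hvD2 := v_D_two_eq hσ hvσ hfix hϖ ρ s hs2 hs hx hζ hy'' V hV hD hvert
  have hvD0 := v_D_zero_eq hvσ hϖ ρ s V hV hD hvert hvD2 hvD1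
  exact ⟨⟨hf, hR, hvf⟩, ⟨hD1, hvNf⟩, ⟨hvD2, hvD1, hvD0⟩, v_cofactor_le hvσ hϖ0 ρ s V hV hvert hvD2 hD1⟩


end Summit.HodgeConjecture.HodgeConjecture.Cruxes.H413.F0P3cDyRamDiagonalGluedPolarisationStructureTypeTwo

end
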